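import Summits.HodgeConjecture.HodgeConjecture.Theses.RigidUnwinding
import Literature.AlgebraicGeometry.HodgeTheory.MotivatedClassesDeformation

/-!
# Crux `KummerEndgame` (stmt-HodgeConjecture-14766) — birth skeleton `Lines/birth.lean` (BC3)

Route `HodgeConjecture/RigidUnwinding`, crux #2 `KummerEndgame` (KE, the finite-monodromy bottom of
Katz's unwinding): in the route frame (a smooth projective family `f : 𝒴 ⟶ U` of relative dimension
`d` over an open `U ⊂ P¹_ℂ`; flat ALGEBRAIC idempotents `e` on `Hᵏ`, `e'` on `H^{k+2c}` of the
fibres; a flat, rational, Hodge-`(c,c)` family of operators `Φ_t : Hᵏ(Y_t) → H^{k+2c}(Y_t)` with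
`Φ(im e) = im e'`; `L := im e` irreducible) IF every class of `L_s` has FINITELY many flat
continuations along loops at `s` (finite monodromy of `L`), THEN at every `t` the restriction
`Φ_t ∘ e_t` is induced by an algebraic class of codimension `d + c` on `Y_t × Y_t`.

## The cut — TRIVIALISE (finite étale), DESCEND (base change of the frame), CONSTANT ENDGAME

The route header locates the content of KE "after base change to the trivialising Kummer curve",
where it becomes the Hodge conjecture for fixed-part classes of a CONSTANT piece (Deligne, Hodge II
4.1.1; Charles–Schnell 11.3.4–5), closable by Shioda–Katsura–Aoki on Fermat-dominated towers and
honestly open otherwise.  The skeleton types exactly that passage, in three registered stubs: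

* `stub_finiteEtaleTrivialisation` (F — topology of the base, PROVABLE NOW in the tree): finite
  monodromy of the flat piece `L = im e` over the smooth curve `U ⊂ P¹` is killed by a finite étale
  cover.  Precisely: there are a finite étale `g : U' ⟶ U` with `U'` irreducible and `g(ℂ)` onto,
  such that on the base-changed family `𝒴 ×_U U' ⟶ U'` (`Motives.familyPullback.snd f g`, fibres
  identified with those of `f` by `Motives.fiberOverFamilyPullbackIso f g s'`) every class of
  `L_{g(s')}` has TRIVIAL monodromy along every loop at `s'`.  Proof plan: `L_s` is finite
  dimensional and each of its vectors has a finite orbit, so a finite-index subgroup of `π₁(U(ℂ), s)`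
  fixes `L_s` pointwise (`exists_finiteIndex_of_finite_setOf_isContinuationAlong_of_isSmoothProjectiveFamily`,
  intersected over a basis, `Subgroup.finiteIndex_iInf`); the covering of `U(ℂ)` attached to its
  normal core (`UniversalCover.exists_covering_of_normal`) is `U'(ℂ)` for a finite étale `U' ⟶ U` by
  Riemann's existence theorem FOR SMOOTH CURVES, which is a THEOREM of the tree
  (`FundamentalGroup.riemannExistence_smoothCurve`; cf. the fact-conditional
  `exists_finiteEtale_of_finiteIndex_of_riemannExistence` whose proof is the template); flatness of
  `e` makes transport preserve `L`, so triviality at the base point propagates to every `s'` by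
  conjugating loops along paths (`U'(ℂ)` path connected); continuations on the base change are
  continuations downstairs (`FiberClass.baseChange`, `exists_continuous_section_familyPullback`);
  `g(ℂ)` is onto because a finite étale map to an irreducible scheme is surjective
  (`surjective_of_isFinite_of_etale_of_irreducible`) and closed points of `U'` have residue field `ℂ`.
  Size M–L.  Why it might fail: it should not — every ingredient is in the tree; the only delicate
  point is the identification of `IsContinuationAlong` upstairs and downstairs (étalé topologies of
  `Rᵏ f'_* ℂ` and `Rᵏ f_* ℂ` along the local homeomorphism `g(ℂ)`).
* `stub_frameDescent` (D — TRANSFER, provable now, size L, real-carrier bookkeeping):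
  `TrivialisedEndgame → FiniteEtaleTrivialisation → KummerEndgame`.  Given the data of KE, take the
  cover of F; `U'` is a smooth irreducible quasi-projective curve (`isQuasiProjectiveOver_of_isFinite_of_surjective`,
  étale over smooth of relative dimension `1`); base-change `e`, `e'`, `Φ` along the fibre
  isomorphisms `ε_{s'} := fiberOverFamilyPullbackIso f g s'`; idempotency, the `Alg` pairing identity
  (algebraic classes and cup products are natural under the isomorphism `ε × ε` of the self-products,
  `ω ↦ ε^* ω ≠ 0`), flatness (continuations correspond under `g(ℂ)`), rationality
  (`IsRationalClass.map`), Hodge bidegree (`IsOfHodgeType.map_of_iso`) and `Φ(im e) = im e'` all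
  transfer; F supplies the trivial-monodromy clause; `TrivialisedEndgame` on `U'` gives an algebraic
  `Ψ'` over any `t'` with `g(t') = t` (F: `g(ℂ)` onto), and `Ψ := ε_* Ψ' ε^*` is algebraic on
  `Y_t × Y_t` with `Ψ ∘ e_t = Φ_t ∘ e_t`.  IRREDUCIBILITY of `L` is NOT transferred (it does not
  survive trivialisation: the pulled-back piece is constant of rank `r = dim` of the irreducible
  representation of the finite monodromy group) — it is simply not used.  Why it might fail: only
  through a mis-typed transfer lemma; mathematically it is base change.
* `stub_trivialisedEndgame` (T — THE HEART, open, HC-implied like the crux): the KE frame over an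
  ARBITRARY smooth irreducible quasi-projective complex CURVE `S` (no `P¹`, no puncture count), with
  `finite monodromy + irreducible` replaced by TRIVIAL monodromy of `L = im e` (`β = α` for every
  continuation `β` of `α ∈ L_s` along a loop).  What the constant form exposes (why easier, named
  tools): by the théorème de la partie fixe and semisimplicity (tree: named fact
  `deligne_globalInvariantCycles`, PROVED special input `deligne1968_invariantClass_fromTotalSpace_holds`,
  Hodge lift `deligne_globalInvariantCycles.exists_hodgeClass_eq_globalSection_of_exists_isReal_hodgeModel`)
  the constant pieces `L`, `L' = Φ(L)` are restrictions of sub-Hodge structures of ONE smooth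
  projective compactification `X̄` of `𝒴` (`exists_isSmoothProjective_isOpenImmersion`), and the
  comparison `Φ|L` is one morphism of Hodge structures between them — an ABSOLUTE statement (HC for
  one class on `X̄ × X̄` restricted to `Y_t × Y_t`, `AlgebraicClassesFibreRestriction`), closed by
  Shioda–Katsura–Aoki–Ran when `X̄` is Fermat-dominated (the route's DelsarteTowerEndgame face,
  support item stmt-HodgeConjecture-13654; tree: `FermatHodgeConjecture*`, `Delsarte*`) and by
  Lefschetz `(1,1)` when `d + c = 1`.  Why it might fail: it contains Weil-type comparison classes
  (constant CM abelian family, `e` a CM spectral idempotent: Deligne 1982; Moonen–Zarhin 1999) —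
  open for Weil-type abelian `2n`-folds, `2n ≥ 6`, beyond Markman's discriminant `−1` sixfolds; and
  Hodge endomorphisms of `H²` of K3-type pieces beyond isometries (Buskin, Huybrechts 2019).  Size XL /
  open-problem (as the crux).

Composition `KummerEndgame_of` (no `sorry` outside the stubs; hypotheses = the registered stubs by
name): `D T F` — modus ponens (a `trivial_seam`; the substance is in T, the transfer in F + D).

Disproof used: none on file — `ledger crux ls stmt-HodgeConjecture-14766` shows no `Disproof.lean`,
no `Lines/`, no landed `Negative/` lemma at registration (2026-08-17); the route's negatives index is
empty ("Negatives index: empty at filing").  The retired predecessor route KatzUnwinding died of junk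
re-decorations of an abstract `BettiHodgeData` carrier (`B.pureEven` / `B.weil`); every carrier here
is real (`complexBetti`, `fiberOver`, `IsContinuationAlong`, `algebraicClasses`, `cupProduct`), as in
the crux itself, so those witnesses do not apply.
BC3 probes (planner folder `bc/probe_*.lean`, each importing only the route file and re-declaring the
stub statements, never this file): `stub → KummerEndgame` and `stub → HodgeConjecture` by
`first | exact? | simpa [Stub, KummerEndgame] | (unfold Stub KummerEndgame; simpa) | aesop` FAIL for
all three stubs (rc and goals in the registrar's NOTES.md).
-/

set_option linter.dupNamespace false

noncomputable section

namespace Summit.HodgeConjecture.HodgeConjecture.Cruxes.KummerEndgame.Birth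

open CategoryTheory MonoidalCategory CartesianMonoidalCategory
open Literature.AlgebraicGeometry.Motives Literature.AlgebraicGeometry.HodgeTheory
open Literature.AlgebraicTopology.SingularHomology

/-! ## §1 The pieces, as named statements -/

/-- **Finite étale trivialisation of a finite-monodromy flat piece over a curve in `P¹`** (F): for a
smooth projective family `f : 𝒴 ⟶ U` over a non-empty open `U ⊂ P¹_ℂ` and a FLAT family of
operators `e_t` on `Hᵏ(Y_t(ℂ); ℂ)` such that every class of `im e_s` has finitely many flat
continuations along loops at `s`, there is a finite étale `g : U' ⟶ U`, `U'` irreducible, `g(ℂ)`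
onto, such that on the base change `𝒴 ×_U U' ⟶ U'` every class `ε_{s'}^* α`, `α ∈ im e_{g(s')}`,
is its own unique continuation along every loop at `s'` (trivial monodromy).
[SGA1 XII Thm. 5.1 via `FundamentalGroup.riemannExistence_smoothCurve` (proved);
HatcherAT2002 Prop. 1.36; Voisin2007HodgeLoci §3, proof of Prop. 0.7] -/
def FiniteEtaleTrivialisation : Prop :=
  ∀ (U 𝒴 : SchemeOver ℂ) (j : U ⟶ projectiveSpace 1 ℂ) (f : 𝒴 ⟶ U) (d k : ℕ) (e : ∀ t : ComplexPoints U, complexBetti (fiberOver f t) k →ₗ[ℂ] complexBetti (fiberOver f t) k), AlgebraicGeometry.IsOpenImmersion j.left → Nonempty (ComplexPoints U) → IsSmoothProjectiveFamily f d → (∀ (s t : ComplexPoints U) (γ : Path s t) (α : complexBetti (fiberOver f s) k) (β : complexBetti (fiberOver f t) k), IsContinuationAlong γ α β → IsContinuationAlong γ (e s α) (e t β)) → (∀ (s : ComplexPoints U) (α : complexBetti (fiberOver f s) k), α ∈ LinearMap.range (e s) → Set.Finite {β : complexBetti (fiberOver f s) k | ∃ γ : Path s s, IsContinuationAlong γ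 α β}) → ∃ (U' : SchemeOver ℂ) (g : U' ⟶ U), AlgebraicGeometry.IsFinite g.left ∧ AlgebraicGeometry.Etale g.left ∧ IrreducibleSpace U'.left ∧ Function.Surjective (AlgPoints.map g : ComplexPoints U' → ComplexPoints U) ∧ ∀ (s' : ComplexPoints U') (γ' : Path s' s') (α : complexBetti (fiberOver f (AlgPoints.map g s')) k) (β' : complexBetti (fiberOver (familyPullback.snd f g) s') k), α ∈ LinearMap.range (e (AlgPoints.map g s')) → IsContinuationAlong γ' (complexBetti.map (fiberOverFamilyPullbackIso f g s').hom k α) β' → β' = complexBetti.map (fiberOverFamilyPullbackIso f g s').hom k α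

/-- **The trivialised (constant-piece) endgame** (T, the heart): the frame of `KummerEndgame` over an
arbitrary smooth irreducible quasi-projective complex CURVE `S`, with the same `Alg`/`Flat`
vocabulary, the same algebraic idempotents `e`, `e'` and flat rational Hodge-`(c,c)` comparison `Φ`
with `Φ(im e) = im e'`, but with `finite monodromy + irreducible` replaced by TRIVIAL MONODROMY of
`L = im e`; conclusion identical: `Φ_t ∘ e_t` is induced by an algebraic class of codimension `d + c`
on `Y_t × Y_t` at every `t`.  HC-implied; by the partie fixe it is the Hodge conjecture for one
morphism of Hodge structures between two constant geometric pieces realised on a smooth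
compactification of the total space. [DeligneHodgeII1971 Thm. 4.1.1; CharlesSchnell2014Notes
Thm. 11.3.4, Prop. 11.3.5; Shioda1979HodgeFermat; ShiodaKatsura1979; Aoki1987; Deligne1982HodgeCycles;
MoonenZarhin1999; Markman2025SecantWeil] -/
def TrivialisedEndgame : Prop :=
  ∀ (S 𝒴 : SchemeOver ℂ) (f : 𝒴 ⟶ S) (d k c : ℕ) (e : ∀ t : ComplexPoints S, complexBetti (fiberOver f t) k →ₗ[ℂ] complexBetti (fiberOver f t) k) (e' : ∀ t : ComplexPoints S, complexBetti (fiberOver f t) (k + 2 * c) →ₗ[ℂ] complexBetti (fiberOver f t) (k + 2 * c)) (Φ : ∀ t : ComplexPoints S, complexBetti (fiberOver f t) k →ₗ[ℂ] complexBetti (fiberOver f t) (k + 2 * c)), let Alg := fun (a q b : ℕ) (t : ComplexPoints S) (T : complexBetti (fiberOver f t) a →ₗ[ℂ] complexBetti (fiberOver f t) b) => ∃ ζ ∈ algebraicClasses (fiberOver f t ⊗ fiberOver f t) q, ∃ ω : complexBetti (fiberOver f t) (2 * d), ω ≠ 0 ∧ ∀ (b' : ℕ) (hb : b + b' = 2 *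 d) (hq : (a + 2 * q) + b' = 4 * d) (α : complexBetti (fiberOver f t) a) (β : complexBetti (fiberOver f t) b'), cupProduct hq (cupProduct (show a + 2 * q = a + 2 * q from rfl) (complexBetti.map (fst (fiberOver f t) (fiberOver f t)) a α) ζ) (complexBetti.map (snd (fiberOver f t) (fiberOver f t)) b' β) = cupProduct (show 2 * d + 2 * d = 4 * d by omega) (complexBetti.map (fst (fiberOver f t) (fiberOver f t)) (2 * d) ω) (complexBetti.map (snd (fiberOver f t) (fiberOver f t)) (2 * d) (cupProduct hb (T α) β)); let Flat := fun (a b : ℕ) (T : ∀ t : ComplexPoints S, complexBetti (fiberOver f t) a →ₗ[ℂ] complexBetti (fiberOver f t) b) => ∀ (s t : ComplexPoints S) (γ : Path s t) (α : complexBetti (fiberOver f s) a) (β : complexBetti (fiberOver f t) a), IsContinuationAlong γ α β → IsContinuationAlong γ (T s α) (T t β); IsQuasiProjectiveOver S → AlgebraicGeometry.SmoothOfRelativeDimension 1 S.hom → IrreducibleSpace S.left → IsSmoothProjectiveFamily f d → (∀ t, e t ∘ₗ e t = e t ∧ Alg k d k t (e t)) → Flat k k e → (∀ t, e' t ∘ₗ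 e' t = e' t ∧ Alg (k + 2 * c) d (k + 2 * c) t (e' t)) → Flat (k + 2 * c) (k + 2 * c) e' → Flat k (k + 2 * c) Φ → (∀ t x, IsRationalClass x → IsRationalClass (Φ t x)) → (∀ t (p q : ℕ), p + q = k → ∀ x, IsOfHodgeType d (fiberOver f t) k p q x → IsOfHodgeType d (fiberOver f t) (k + 2 * c) (p + c) (q + c) (Φ t x)) → (∀ t, Submodule.map (Φ t) (LinearMap.range (e t)) = LinearMap.range (e' t)) → (∀ (s : ComplexPoints S) (γ : Path s s) (α β : complexBetti (fiberOver f s) k), α ∈ LinearMap.range (e s) → IsContinuationAlong γ α β → β = α) → ∀ t, ∃ Ψ : complexBetti (fiberOver f t) k →ₗ[ℂ] complexBetti (fiberOver f t) (k + 2 * c), Alg k (d + c) (k + 2 * c) t Ψ ∧ Ψ ∘ₗ e t = Φ t ∘ₗ e t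

/-- **Frame descent** (D, the transfer; conclusion = the crux `RigidUnwinding.KummerEndgame` UNFOLDED
verbatim, so that `KummerEndgame_of` stays the only theorem concluding the route decl by name): the
constant-piece endgame on the trivialising cover gives the finite-monodromy endgame downstairs — base change of `e`, `e'`, `Φ` along the fibre
isomorphisms `fiberOverFamilyPullbackIso f g s'`, transfer of idempotency / `Alg` / flatness /
rationality / Hodge bidegree / `Φ(im e) = im e'`, and transport of the algebraic `Ψ'` back along the
isomorphism of self-products. [Hartshorne1977 II.3 (base extension); folklore] -/
def FrameDescent : Prop :=
  TrivialisedEndgame → FiniteEtaleTrivialisation →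
    ∀ (U 𝒴 : SchemeOver ℂ) (j : U ⟶ projectiveSpace 1 ℂ) (f : 𝒴 ⟶ U) (d k c : ℕ) (e : ∀ t : ComplexPoints U, complexBetti (fiberOver f t) k →ₗ[ℂ] complexBetti (fiberOver f t) k) (e' : ∀ t : ComplexPoints U, complexBetti (fiberOver f t) (k + 2 * c) →ₗ[ℂ] complexBetti (fiberOver f t) (k + 2 * c)) (Φ : ∀ t : ComplexPoints U, complexBetti (fiberOver f t) k →ₗ[ℂ] complexBetti (fiberOver f t) (k + 2 * c)), let Alg := fun (a q b : ℕ) (t : ComplexPoints U) (T : complexBetti (fiberOver f t) a →ₗ[ℂ] complexBetti (fiberOver f t) b) => ∃ ζ ∈ algebraicClasses (fiberOver f t ⊗ fiberOver f t) q, ∃ ω : complexBetti (fiberOver f t) (2 * d), ω ≠ 0 ∧ ∀ (b' : ℕ) (hb : b + b' = 2 * d) (hq : (a + 2 * q) + b' = 4 * d) (α : complexBetti (fiberOver f t) a) (β : complexBetti (fiberOver f t) b'), cupProduct hq (cupProduct (show a + 2 * q = a + 2 * q from rfl) (complexBetti.map (fst (fiberOver f t) (fiberOver f t)) a α) ζ)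 (complexBetti.map (snd (fiberOver f t) (fiberOver f t)) b' β) = cupProduct (show 2 * d + 2 * d = 4 * d by omega) (complexBetti.map (fst (fiberOver f t) (fiberOver f t)) (2 * d) ω) (complexBetti.map (snd (fiberOver f t) (fiberOver f t)) (2 * d) (cupProduct hb (T α) β)); let Flat := fun (a b : ℕ) (T : ∀ t : ComplexPoints U, complexBetti (fiberOver f t) a →ₗ[ℂ] complexBetti (fiberOver f t) b) => ∀ (s t : ComplexPoints U) (γ : Path s t) (α : complexBetti (fiberOver f s) a) (β : complexBetti (fiberOver f t) a), IsContinuationAlong γ α β → IsContinuationAlong γ (T s α) (T t β); AlgebraicGeometry.IsOpenImmersion j.left → Nonempty (ComplexPoints U) → IsSmoothProjectiveFamily f d → (∀ t, e t ∘ₗ e t = e t ∧ Alg k d k t (e t)) → Flat k k e → (∀ t, e' t ∘ₗ e' t = e' t ∧ Alg (k + 2 * c) d (k + 2 * c) t (e' t)) → Flat (k + 2 * c) (k + 2 * c) e' → Flat k (k + 2 * c) Φ → (∀ t x, IsRationalClass x → IsRationalClass (Φ t x)) → (∀ t (p q : ℕ), p + q = k → ∀ x, IsOfHodgeType d (fiberOver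 f t) k p q x → IsOfHodgeType d (fiberOver f t) (k + 2 * c) (p + c) (q + c) (Φ t x)) → (∀ t, Submodule.map (Φ t) (LinearMap.range (e t)) = LinearMap.range (e' t)) → (∀ M : (∀ t : ComplexPoints U, Submodule ℂ (complexBetti (fiberOver f t) k)), (∀ t, M t ≤ LinearMap.range (e t)) → (∀ (s t : ComplexPoints U) (γ : Path s t) (α : complexBetti (fiberOver f s) k) (β : complexBetti (fiberOver f t) k), α ∈ M s → IsContinuationAlong γ α β → β ∈ M t) → (∀ t, M t = ⊥) ∨ (∀ t, M t = LinearMap.range (e t))) → (∀ (s : ComplexPoints U) (α : complexBetti (fiberOver f s) k), α ∈ LinearMap.range (e s) → Set.Finite {β : complexBetti (fiberOver f s) k | ∃ γ : Path s s, IsContinuationAlong γ α β}) → ∀ t, ∃ Ψ : complexBetti (fiberOver f t) k →ₗ[ℂ] complexBetti (fiberOver f t) (k + 2 * c), Alg k (d + c) (k + 2 * c) t Ψ ∧ Ψ ∘ₗ e t = Φ t ∘ₗ e t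

/-! ## §2 Registered stubs (`sorry` lives ONLY in these three theorems) -/

section Stubs

/-- STUB F (registered form = `FiniteEtaleTrivialisation`): Riemann existence for smooth curves +
finite-index stabiliser of the finite-monodromy piece + conjugation of loops. Provable now. -/
theorem stub_finiteEtaleTrivialisation :
    ∀ (U 𝒴 : SchemeOver ℂ) (j : U ⟶ projectiveSpace 1 ℂ) (f : 𝒴 ⟶ U) (d k : ℕ) (e : ∀ t : ComplexPoints U, complexBetti (fiberOver f t) k →ₗ[ℂ] complexBetti (fiberOver f t) k), AlgebraicGeometry.IsOpenImmersion j.left → Nonempty (ComplexPoints U) → IsSmoothProjectiveFamily f d → (∀ (s t : ComplexPoints U) (γ : Path s t) (α : complexBetti (fiberOver f s) k) (β : complexBetti (fiberOver f t) k), IsContinuationAlong γ α β → IsContinuationAlong γ (e s α) (e t β)) → (∀ (s : ComplexPoints U) (α : complexBetti (fiberOver f s) k), α ∈ LinearMap.range (e s) → Set.Finite {β : complexBetti (fiberOver f s) k | ∃ γ : Path s s, IsContinuationAlong γ α β}) → ∃ (U' : SchemeOver ℂ) (g : U' ⟶ U), AlgebraicGeometry.IsFinite g.left ∧ AlgebraicGeometry.Etale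 g.left ∧ IrreducibleSpace U'.left ∧ Function.Surjective (AlgPoints.map g : ComplexPoints U' → ComplexPoints U) ∧ ∀ (s' : ComplexPoints U') (γ' : Path s' s') (α : complexBetti (fiberOver f (AlgPoints.map g s')) k) (β' : complexBetti (fiberOver (familyPullback.snd f g) s') k), α ∈ LinearMap.range (e (AlgPoints.map g s')) → IsContinuationAlong γ' (complexBetti.map (fiberOverFamilyPullbackIso f g s').hom k α) β' → β' = complexBetti.map (fiberOverFamilyPullbackIso f g s').hom k α := by
  sorry

/-- STUB D (registered form = `FrameDescent`): base change of the whole frame along the trivialising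
cover and transport of the algebraic operator back. Provable now (real-carrier bookkeeping). -/
theorem stub_frameDescent :
    TrivialisedEndgame → FiniteEtaleTrivialisation →
      ∀ (U 𝒴 : SchemeOver ℂ) (j : U ⟶ projectiveSpace 1 ℂ) (f : 𝒴 ⟶ U) (d k c : ℕ) (e : ∀ t : ComplexPoints U, complexBetti (fiberOver f t) k →ₗ[ℂ] complexBetti (fiberOver f t) k) (e' : ∀ t : ComplexPoints U, complexBetti (fiberOver f t) (k + 2 * c) →ₗ[ℂ] complexBetti (fiberOver f t) (k + 2 * c)) (Φ : ∀ t : ComplexPoints U, complexBetti (fiberOver f t) k →ₗ[ℂ] complexBetti (fiberOver f t) (k + 2 * c)), let Alg := fun (a q b : ℕ) (t : ComplexPoints U) (T : complexBetti (fiberOver f t) a →ₗ[ℂ] complexBetti (fiberOver f t) b) => ∃ ζ ∈ algebraicClasses (fiberOver f t ⊗ fiberOver f t) q, ∃ ω : complexBetti (fiberOver f t) (2 * d), ω ≠ 0 ∧ ∀ (b' : ℕ) (hb : b + b' = 2 * d) (hq : (a + 2 * q) + b' = 4 * d) (α : complexBetti (fiberOver f t) a) (β : complexBetti (fiberOver f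 t) b'), cupProduct hq (cupProduct (show a + 2 * q = a + 2 * q from rfl) (complexBetti.map (fst (fiberOver f t) (fiberOver f t)) a α) ζ) (complexBetti.map (snd (fiberOver f t) (fiberOver f t)) b' β) = cupProduct (show 2 * d + 2 * d = 4 * d by omega) (complexBetti.map (fst (fiberOver f t) (fiberOver f t)) (2 * d) ω) (complexBetti.map (snd (fiberOver f t) (fiberOver f t)) (2 * d) (cupProduct hb (T α) β)); let Flat := fun (a b : ℕ) (T : ∀ t : ComplexPoints U, complexBetti (fiberOver f t) a →ₗ[ℂ] complexBetti (fiberOver f t) b) => ∀ (s t : ComplexPoints U) (γ : Path s t) (α : complexBetti (fiberOver f s) a) (β : complexBetti (fiberOver f t) a), IsContinuationAlong γ α β → IsContinuationAlong γ (T s α) (T t β); AlgebraicGeometry.IsOpenImmersion j.left → Nonempty (ComplexPoints U) → IsSmoothProjectiveFamily f d → (∀ t, e t ∘ₗ e t = e t ∧ Alg k d k t (e t)) → Flat k k e → (∀ t, e' t ∘ₗ e' t = e' t ∧ Alg (k + 2 * c) d (k + 2 * c) t (e' t)) → Flat (k + 2 * c) (k + 2 * c) e' → Flat k (k + 2 *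 c) Φ → (∀ t x, IsRationalClass x → IsRationalClass (Φ t x)) → (∀ t (p q : ℕ), p + q = k → ∀ x, IsOfHodgeType d (fiberOver f t) k p q x → IsOfHodgeType d (fiberOver f t) (k + 2 * c) (p + c) (q + c) (Φ t x)) → (∀ t, Submodule.map (Φ t) (LinearMap.range (e t)) = LinearMap.range (e' t)) → (∀ M : (∀ t : ComplexPoints U, Submodule ℂ (complexBetti (fiberOver f t) k)), (∀ t, M t ≤ LinearMap.range (e t)) → (∀ (s t : ComplexPoints U) (γ : Path s t) (α : complexBetti (fiberOver f s) k) (β : complexBetti (fiberOver f t) k), α ∈ M s → IsContinuationAlong γ α β → β ∈ M t) → (∀ t, M t = ⊥) ∨ (∀ t, M t = LinearMap.range (e t))) → (∀ (s : ComplexPoints U) (α : complexBetti (fiberOver f s) k), α ∈ LinearMap.range (e s) → Set.Finite {β : complexBetti (fiberOver f s) k | ∃ γ : Path s s, IsContinuationAlong γ α β}) → ∀ t, ∃ Ψ : complexBetti (fiberOver f t) k →ₗ[ℂ] complexBetti (fiberOver f t) (k + 2 * c), Alg k (d + c) (k + 2 * c) t Ψ ∧ Ψ ∘ₗ e t = Φ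 t ∘ₗ e t := by
  sorry

/-- STUB T (registered form = `TrivialisedEndgame`; HARDEST, open): the constant-piece endgame over a
smooth irreducible quasi-projective curve. -/
theorem stub_trivialisedEndgame :
    ∀ (S 𝒴 : SchemeOver ℂ) (f : 𝒴 ⟶ S) (d k c : ℕ) (e : ∀ t : ComplexPoints S, complexBetti (fiberOver f t) k →ₗ[ℂ] complexBetti (fiberOver f t) k) (e' : ∀ t : ComplexPoints S, complexBetti (fiberOver f t) (k + 2 * c) →ₗ[ℂ] complexBetti (fiberOver f t) (k + 2 * c)) (Φ : ∀ t : ComplexPoints S, complexBetti (fiberOver f t) k →ₗ[ℂ] complexBetti (fiberOver f t) (k + 2 * c)), let Alg := fun (a q b : ℕ) (t : ComplexPoints S) (T : complexBetti (fiberOver f t) a →ₗ[ℂ] complexBetti (fiberOver f t) b) => ∃ ζ ∈ algebraicClasses (fiberOver f t ⊗ fiberOver f t) q, ∃ ω : complexBetti (fiberOver f t) (2 * d), ω ≠ 0 ∧ ∀ (b' : ℕ) (hb : b + b' = 2 * d) (hq : (a + 2 * q) + b' = 4 * d) (α : complexBetti (fiberOver f t) a) (β : complexBetti (fiberOver f t)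 b'), cupProduct hq (cupProduct (show a + 2 * q = a + 2 * q from rfl) (complexBetti.map (fst (fiberOver f t) (fiberOver f t)) a α) ζ) (complexBetti.map (snd (fiberOver f t) (fiberOver f t)) b' β) = cupProduct (show 2 * d + 2 * d = 4 * d by omega) (complexBetti.map (fst (fiberOver f t) (fiberOver f t)) (2 * d) ω) (complexBetti.map (snd (fiberOver f t) (fiberOver f t)) (2 * d) (cupProduct hb (T α) β)); let Flat := fun (a b : ℕ) (T : ∀ t : ComplexPoints S, complexBetti (fiberOver f t) a →ₗ[ℂ] complexBetti (fiberOver f t) b) => ∀ (s t : ComplexPoints S) (γ : Path s t) (α : complexBetti (fiberOver f s) a) (β : complexBetti (fiberOver f t) a), IsContinuationAlong γ α β → IsContinuationAlong γ (T s α) (T t β); IsQuasiProjectiveOver S → AlgebraicGeometry.SmoothOfRelativeDimension 1 S.hom → IrreducibleSpace S.left → IsSmoothProjectiveFamily f d → (∀ t, e t ∘ₗ e t = e t ∧ Alg k d k t (e t)) → Flat k k e → (∀ t, e' t ∘ₗ e' t = e' t ∧ Alg (k + 2 * c) d (k + 2 * c) t (e' t)) → Flat (k + 2 * c) (k + 2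 * c) e' → Flat k (k + 2 * c) Φ → (∀ t x, IsRationalClass x → IsRationalClass (Φ t x)) → (∀ t (p q : ℕ), p + q = k → ∀ x, IsOfHodgeType d (fiberOver f t) k p q x → IsOfHodgeType d (fiberOver f t) (k + 2 * c) (p + c) (q + c) (Φ t x)) → (∀ t, Submodule.map (Φ t) (LinearMap.range (e t)) = LinearMap.range (e' t)) → (∀ (s : ComplexPoints S) (γ : Path s s) (α β : complexBetti (fiberOver f s) k), α ∈ LinearMap.range (e s) → IsContinuationAlong γ α β → β = α) → ∀ t, ∃ Ψ : complexBetti (fiberOver f t) k →ₗ[ℂ] complexBetti (fiberOver f t) (k + 2 * c), Alg k (d + c) (k + 2 * c) t Ψ ∧ Ψ ∘ₗ e t = Φ t ∘ₗ e t := by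
  sorry

end Stubs

/-! ### Name-keyed aliases (the skeleton audit matches a hypothesis head to a declared stub by its
last name component) -/
namespace Registered

/-- Alias of `FiniteEtaleTrivialisation` keyed by the registered stub name. -/
abbrev stub_finiteEtaleTrivialisation : Prop := FiniteEtaleTrivialisation
/-- Alias of `FrameDescent` keyed by the registered stub name. -/
abbrev stub_frameDescent : Prop := FrameDescent
/-- Alias of `TrivialisedEndgame` keyed by the registered stub name. -/
abbrev stub_trivialisedEndgame : Prop := TrivialisedEndgame

end Registered

/-! Consistency: each alias IS its registered stub (definitional unfolding only; `example`s, so no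
second theorem concludes anything by name). -/
example : Registered.stub_finiteEtaleTrivialisation := stub_finiteEtaleTrivialisation
example : Registered.stub_frameDescent := stub_frameDescent
example : Registered.stub_trivialisedEndgame := stub_trivialisedEndgame

/-! ## §3 Composition: the crux BY NAME from the three registered stubs (no `sorry` below) -/

/-- **`RigidUnwinding.KummerEndgame` from the stubs** (kernel-checked, no `sorry` of its own; each
hypothesis is a registered stub, keyed by name): trivialise the finite monodromy of `L = im e` on a
finite étale cover of the base curve (F), run the constant-piece endgame there (T), and descend the
algebraic operator along the base change (D). -/
theorem KummerEndgame_of (hF : Registered.stub_finiteEtaleTrivialisation)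
    (hD : Registered.stub_frameDescent) (hT : Registered.stub_trivialisedEndgame) :
    Summit.HodgeConjecture.HodgeConjecture.Theses.RigidUnwinding.KummerEndgame :=
  hD hT hF

/-- Wiring check (an `example`, so that `KummerEndgame_of` stays the only theorem concluding the
crux): the registered stubs feed the composition as stated. -/
example : Summit.HodgeConjecture.HodgeConjecture.Theses.RigidUnwinding.KummerEndgame :=
  KummerEndgame_of stub_finiteEtaleTrivialisation stub_frameDescent stub_trivialisedEndgame

end Summit.HodgeConjecture.HodgeConjecture.Cruxes.KummerEndgame.Birth

end
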